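import Mathlib
import HarnessLib
import Summits.NavierStokesRegularity.NavierStokesRegularity.Theorems.ChiralWindowDoorDefs
import Summits.NavierStokesRegularity.NavierStokesRegularity.Theorems.ChiralWindowDoorSymmetrisation

/-!
# Door S20 «ChiralWindowDoor» — the symmetrisation identity for the TRUNCATED kernels `K_ε`, with every
# integrability hypothesis discharged (B1′ step (iv) of nsreg-p1's R19-LINE)

Door S20 of nsreg-p1's local Type-I door family (`HOME/ns-regularity-ideate-p1/r19/R19-LINE.md` §B1′, §AUDIT NOTES;
DESIGN-ONLY, route NOT born).  The abstract identity `…ChiralWindowDoorSymmetrisation.locHelicity_symmetrisation`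
(`∫ a⟪f, L_K f⟫ = ¼∬(a x+a y)K‖f x−f y‖² + ½∫‖f‖² L_K a`, even kernel `K`) carries four integrability hypotheses which
FAIL for the kernel `lamK = π⁻²‖z‖⁻⁴` itself (first differences are only principal values) and HOLD for its truncations
`K_ε = lamKTrunc ε` (R19-LINE, AUDIT NOTES (B1′ integrability)).  This file discharges them:

* `integrable_prod_kernel_right/left` — `(x,y) ↦ k(x−y) h(y)` and `(x,y) ↦ g(x) k(x−y)` are integrable on `ℝ³ × ℝ³` for
  integrable `g, h, k` (`k` even in the left version): the shear `(x,y) ↦ (x−y, y)` preserves Lebesgue measure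
  (Mathlib `measurePreserving_sub_prod`) and `Integrable.mul_prod`;
* `integrable_symF_trunc`, `integrable_symG_trunc`, `integrable_symS_trunc`, `integrable_firstDiff_trunc` — the four
  hypotheses for `K = lamKTrunc ε` (`ε > 0`), a measurable integrable weight `a` and a bounded continuous field `f`;
* `firstDiff_eq_secondDiff_real` — the scalar twin of `…Symmetrisation.firstDiff_eq_secondDiff`;
* `truncated_symmetrisation` — **for every `ε > 0`:
  `∫ a(x)⟪f x, ½∫K_ε(z)(2f x − f(x+z) − f(x−z))dz⟫dx = ¼∬(a x + a y)K_ε(x−y)‖f x − f y‖² + ½∫‖f x‖²·(½∫K_ε(z)(2a x − a(x+z) − a(x−z))dz)dx`**,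
  both one-variable operators already in the SECOND-DIFFERENCE form of the substrate's `fracLapHalf` / `fracLapHalfS`, ready
  for the limit `ε → 0` (`…ChiralWindowDoorGagliardoIdentity`).

Seat nsreg-p6 g11 (THEOREMS-ONLY door sequels, DIRECTOR-NS g8 #32 (2)/#36).  WHAT THIS IS NOT: not NS regularity
(Clay A); not B1′ (the limit `ε → 0`, the kernel bounds and the decay bookkeeping are separate files); no route is opened.
-/

noncomputable section

-- the summit and its single sub-problem share the name (CONVENTIONS §1), as in every Theorems file
set_option linter.dupNamespace false

namespace Summit.NavierStokesRegularity.NavierStokesRegularity.Theorems.ChiralWindowDoorTruncatedSymmetrisation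

open MeasureTheory Set Filter Topology Metric
open scoped RealInnerProductSpace
open Summit.NavierStokesRegularity.NavierStokesRegularity.Theorems.ChiralWindowDoorDefs
open Summit.NavierStokesRegularity.NavierStokesRegularity.Theorems.ChiralWindowDoorSymmetrisation

/-! ### Product-space integrability of sheared products -/

/-- `(x,y) ↦ k(x−y) h(y)` is integrable on `ℝ³ × ℝ³` for integrable `k, h` (the shear `(x,y) ↦ (x−y,y)` preserves
Lebesgue measure). -/
theorem integrable_prod_kernel_right {k h : EuclideanSpace ℝ (Fin 3) → ℝ} (hk : Integrable k) (hh : Integrable h) :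
    Integrable (fun p : EuclideanSpace ℝ (Fin 3) × EuclideanSpace ℝ (Fin 3) => k (p.1 - p.2) * h p.2) := by
  have hT := measurePreserving_sub_prod (volume : Measure (EuclideanSpace ℝ (Fin 3)))
    (volume : Measure (EuclideanSpace ℝ (Fin 3)))
  have hg : Integrable (fun q : EuclideanSpace ℝ (Fin 3) × EuclideanSpace ℝ (Fin 3) => k q.1 * h q.2)
      ((volume : Measure (EuclideanSpace ℝ (Fin 3))).prod volume) := hk.mul_prod hh
  have h := (hT.integrable_comp hg.aestronglyMeasurable).2 hg
  rw [Measure.volume_eq_prod]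
  simpa [Function.comp_def] using h

/-- `(x,y) ↦ g(x) k(x−y)` is integrable on `ℝ³ × ℝ³` for integrable `g` and integrable EVEN `k`. -/
theorem integrable_prod_kernel_left {g k : EuclideanSpace ℝ (Fin 3) → ℝ} (hg : Integrable g) (hk : Integrable k)
    (hk_even : ∀ z, k (-z) = k z) :
    Integrable (fun p : EuclideanSpace ℝ (Fin 3) × EuclideanSpace ℝ (Fin 3) => g p.1 * k (p.1 - p.2)) := by
  have h1 := (integrable_prod_kernel_right hk hg).swap
  rw [Measure.volume_eq_prod]
  refine (h1.congr (Eventually.of_forall fun p => ?_))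
  simp only [Function.comp_apply, Prod.swap]
  rw [← hk_even, neg_sub, mul_comm]

/-! ### The four integrability hypotheses for the truncated kernels -/

section Hypotheses

variable {a : EuclideanSpace ℝ (Fin 3) → ℝ} {f : EuclideanSpace ℝ (Fin 3) → EuclideanSpace ℝ (Fin 3)} {M₀ ε : ℝ}

/-- `symF a f K_ε` is integrable on `ℝ³ × ℝ³` (measurable integrable weight, bounded continuous field, `ε > 0`). -/
theorem integrable_symF_trunc (ham : Measurable a) (hai : Integrable a)
    (hfc : Continuous f) (hf0 : ∀ x, ‖f x‖ ≤ M₀) (hε : 0 < ε) :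
    Integrable (symF a f (lamKTrunc ε)) := by
  have hM₀ : 0 ≤ M₀ := (norm_nonneg _).trans (hf0 0)
  have hdom : Integrable (fun p : EuclideanSpace ℝ (Fin 3) × EuclideanSpace ℝ (Fin 3) =>
      (2 * M₀ ^ 2) * (‖a p.1‖ * lamKTrunc ε (p.1 - p.2))) :=
    (integrable_prod_kernel_left hai.norm (integrable_lamKTrunc hε) (lamKTrunc_neg ε)).const_mul _
  have hmeas : AEStronglyMeasurable (symF a f (lamKTrunc ε))
      (volume : Measure (EuclideanSpace ℝ (Fin 3) × EuclideanSpace ℝ (Fin 3))) := by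
    have hm : Measurable (symF a f (lamKTrunc ε)) := by
      unfold symF
      exact (ham.comp measurable_fst).mul
        (((measurable_lamKTrunc ε).comp (measurable_fst.sub measurable_snd)).mul
          (by fun_prop : Continuous fun p : EuclideanSpace ℝ (Fin 3) × EuclideanSpace ℝ (Fin 3) =>
            ⟪f p.1, f p.1 - f p.2⟫).measurable)
    exact hm.aestronglyMeasurable
  refine hdom.mono' hmeas (Eventually.of_forall fun p => ?_)
  have hK := lamKTrunc_nonneg ε (p.1 - p.2)
  have hin : |⟪f p.1, f p.1 - f p.2⟫| ≤ M₀ * (2 * M₀) := by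
    calc |⟪f p.1, f p.1 - f p.2⟫| ≤ ‖f p.1‖ * ‖f p.1 - f p.2‖ := abs_real_inner_le_norm _ _
      _ ≤ M₀ * (2 * M₀) := by
          refine mul_le_mul (hf0 _) ?_ (norm_nonneg _) hM₀
          calc ‖f p.1 - f p.2‖ ≤ ‖f p.1‖ + ‖f p.2‖ := norm_sub_le _ _
            _ ≤ M₀ + M₀ := add_le_add (hf0 _) (hf0 _)
            _ = 2 * M₀ := by ring
  unfold symF
  rw [Real.norm_eq_abs, abs_mul, abs_mul, abs_of_nonneg hK, Real.norm_eq_abs]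
  calc |a p.1| * (lamKTrunc ε (p.1 - p.2) * |⟪f p.1, f p.1 - f p.2⟫|)
      ≤ |a p.1| * (lamKTrunc ε (p.1 - p.2) * (M₀ * (2 * M₀))) := by gcongr
    _ = 2 * M₀ ^ 2 * (|a p.1| * lamKTrunc ε (p.1 - p.2)) := by ring

/-- `symG a f K_ε` is integrable on `ℝ³ × ℝ³`. -/
theorem integrable_symG_trunc (ham : Measurable a) (hai : Integrable a)
    (hfc : Continuous f) (hf0 : ∀ x, ‖f x‖ ≤ M₀) (hε : 0 < ε) :
    Integrable (symG a f (lamKTrunc ε)) := by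
  have hM₀ : 0 ≤ M₀ := (norm_nonneg _).trans (hf0 0)
  have hdom : Integrable (fun p : EuclideanSpace ℝ (Fin 3) × EuclideanSpace ℝ (Fin 3) =>
      (2 * M₀) ^ 2 * (‖a p.1‖ * lamKTrunc ε (p.1 - p.2)) +
        (2 * M₀) ^ 2 * (lamKTrunc ε (p.1 - p.2) * ‖a p.2‖)) :=
    ((integrable_prod_kernel_left hai.norm (integrable_lamKTrunc hε) (lamKTrunc_neg ε)).const_mul _).add
      ((integrable_prod_kernel_right (integrable_lamKTrunc hε) hai.norm).const_mul _)
  have hmeas : AEStronglyMeasurable (symG a f (lamKTrunc ε))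
      (volume : Measure (EuclideanSpace ℝ (Fin 3) × EuclideanSpace ℝ (Fin 3))) := by
    have hm : Measurable (symG a f (lamKTrunc ε)) := by
      unfold symG
      exact ((ham.comp measurable_fst).add (ham.comp measurable_snd)).mul
        (((measurable_lamKTrunc ε).comp (measurable_fst.sub measurable_snd)).mul
          (by fun_prop : Continuous fun p : EuclideanSpace ℝ (Fin 3) × EuclideanSpace ℝ (Fin 3) =>
            ‖f p.1 - f p.2‖ ^ 2).measurable)
    exact hm.aestronglyMeasurable
  refine hdom.mono' hmeas (Eventually.of_forall fun p => ?_)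
  have hK := lamKTrunc_nonneg ε (p.1 - p.2)
  have hd : ‖f p.1 - f p.2‖ ^ 2 ≤ (2 * M₀) ^ 2 := by
    refine pow_le_pow_left₀ (norm_nonneg _) ?_ 2
    calc ‖f p.1 - f p.2‖ ≤ ‖f p.1‖ + ‖f p.2‖ := norm_sub_le _ _
      _ ≤ M₀ + M₀ := add_le_add (hf0 _) (hf0 _)
      _ = 2 * M₀ := by ring
  unfold symG
  rw [Real.norm_eq_abs, abs_mul, abs_mul, abs_of_nonneg hK, abs_of_nonneg (by positivity : (0 : ℝ) ≤ ‖f p.1 - f p.2‖ ^ 2),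
    Real.norm_eq_abs, Real.norm_eq_abs]
  calc |a p.1 + a p.2| * (lamKTrunc ε (p.1 - p.2) * ‖f p.1 - f p.2‖ ^ 2)
      ≤ (|a p.1| + |a p.2|) * (lamKTrunc ε (p.1 - p.2) * (2 * M₀) ^ 2) := by
        gcongr
        exact abs_add_le _ _
    _ = (2 * M₀) ^ 2 * (|a p.1| * lamKTrunc ε (p.1 - p.2)) +
        (2 * M₀) ^ 2 * (lamKTrunc ε (p.1 - p.2) * |a p.2|) := by ring

/-- `symS a f K_ε` is integrable on `ℝ³ × ℝ³`. -/
theorem integrable_symS_trunc (ham : Measurable a) (hai : Integrable a)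
    (hfc : Continuous f) (hf0 : ∀ x, ‖f x‖ ≤ M₀) (hε : 0 < ε) :
    Integrable (symS a f (lamKTrunc ε)) := by
  have hM₀ : 0 ≤ M₀ := (norm_nonneg _).trans (hf0 0)
  have hdom : Integrable (fun p : EuclideanSpace ℝ (Fin 3) × EuclideanSpace ℝ (Fin 3) =>
      M₀ ^ 2 * (‖a p.1‖ * lamKTrunc ε (p.1 - p.2)) + M₀ ^ 2 * (lamKTrunc ε (p.1 - p.2) * ‖a p.2‖)) :=
    ((integrable_prod_kernel_left hai.norm (integrable_lamKTrunc hε) (lamKTrunc_neg ε)).const_mul _).add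
      ((integrable_prod_kernel_right (integrable_lamKTrunc hε) hai.norm).const_mul _)
  have hmeas : AEStronglyMeasurable (symS a f (lamKTrunc ε))
      (volume : Measure (EuclideanSpace ℝ (Fin 3) × EuclideanSpace ℝ (Fin 3))) := by
    have hm : Measurable (symS a f (lamKTrunc ε)) := by
      unfold symS
      exact (((ham.comp measurable_fst).sub (ham.comp measurable_snd)).mul
        ((measurable_lamKTrunc ε).comp (measurable_fst.sub measurable_snd))).mul
          (by fun_prop : Continuous fun p : EuclideanSpace ℝ (Fin 3) × EuclideanSpace ℝ (Fin 3) =>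
            ‖f p.1‖ ^ 2).measurable
    exact hm.aestronglyMeasurable
  refine hdom.mono' hmeas (Eventually.of_forall fun p => ?_)
  have hK := lamKTrunc_nonneg ε (p.1 - p.2)
  have hd : ‖f p.1‖ ^ 2 ≤ M₀ ^ 2 := pow_le_pow_left₀ (norm_nonneg _) (hf0 _) 2
  unfold symS
  rw [Real.norm_eq_abs, abs_mul, abs_mul, abs_of_nonneg hK, abs_of_nonneg (by positivity : (0 : ℝ) ≤ ‖f p.1‖ ^ 2),
    Real.norm_eq_abs, Real.norm_eq_abs]
  calc |a p.1 - a p.2| * lamKTrunc ε (p.1 - p.2) * ‖f p.1‖ ^ 2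
      ≤ (|a p.1| + |a p.2|) * lamKTrunc ε (p.1 - p.2) * M₀ ^ 2 := by
        gcongr
        exact abs_sub _ _
    _ = M₀ ^ 2 * (|a p.1| * lamKTrunc ε (p.1 - p.2)) + M₀ ^ 2 * (lamKTrunc ε (p.1 - p.2) * |a p.2|) := by ring

/-- For each `x`, `y ↦ K_ε(x−y) • (f x − f y)` is integrable. -/
theorem integrable_firstDiff_trunc (hfc : Continuous f) (hf0 : ∀ x, ‖f x‖ ≤ M₀) (hε : 0 < ε)
    (x : EuclideanSpace ℝ (Fin 3)) :
    Integrable (fun y => lamKTrunc ε (x - y) • (f x - f y)) := by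
  have hk : Integrable (fun y : EuclideanSpace ℝ (Fin 3) => lamKTrunc ε (x - y)) :=
    (integrable_lamKTrunc hε).comp_sub_left x
  refine (hk.const_mul (2 * M₀)).mono' ?_ (Eventually.of_forall fun y => ?_)
  · exact (((measurable_lamKTrunc ε).comp (measurable_const.sub measurable_id)).smul
      (by fun_prop : Continuous fun y => f x - f y).measurable).aestronglyMeasurable
  · rw [norm_smul, Real.norm_eq_abs, abs_of_nonneg (lamKTrunc_nonneg ε _), mul_comm (2 * M₀)]
    refine mul_le_mul_of_nonneg_left ?_ (lamKTrunc_nonneg ε _)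
    calc ‖f x - f y‖ ≤ ‖f x‖ + ‖f y‖ := norm_sub_le _ _
      _ ≤ M₀ + M₀ := add_le_add (hf0 _) (hf0 _)
      _ = 2 * M₀ := by ring

/-- For each `x`, `z ↦ K_ε(z) • (f x − f (x + z))` and `z ↦ K_ε(z) • (f x − f (x − z))` are integrable. -/
theorem integrable_shiftDiff_trunc (hfc : Continuous f) (hf0 : ∀ x, ‖f x‖ ≤ M₀) (hε : 0 < ε)
    (x : EuclideanSpace ℝ (Fin 3)) :
    Integrable (fun z => lamKTrunc ε z • (f x - f (x + z))) ∧
      Integrable (fun z => lamKTrunc ε z • (f x - f (x - z))) := by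
  have hk : Integrable (lamKTrunc ε) := integrable_lamKTrunc hε
  have hb : ∀ w : EuclideanSpace ℝ (Fin 3), ‖f x - f w‖ ≤ 2 * M₀ := fun w => by
    calc ‖f x - f w‖ ≤ ‖f x‖ + ‖f w‖ := norm_sub_le _ _
      _ ≤ M₀ + M₀ := add_le_add (hf0 _) (hf0 _)
      _ = 2 * M₀ := by ring
  constructor
  · refine (hk.const_mul (2 * M₀)).mono' ?_ (Eventually.of_forall fun z => ?_)
    · exact ((measurable_lamKTrunc ε).smul
        (by fun_prop : Continuous fun z => f x - f (x + z)).measurable).aestronglyMeasurable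
    · rw [norm_smul, Real.norm_eq_abs, abs_of_nonneg (lamKTrunc_nonneg ε _), mul_comm (2 * M₀)]
      exact mul_le_mul_of_nonneg_left (hb _) (lamKTrunc_nonneg ε _)
  · refine (hk.const_mul (2 * M₀)).mono' ?_ (Eventually.of_forall fun z => ?_)
    · exact ((measurable_lamKTrunc ε).smul
        (by fun_prop : Continuous fun z => f x - f (x - z)).measurable).aestronglyMeasurable
    · rw [norm_smul, Real.norm_eq_abs, abs_of_nonneg (lamKTrunc_nonneg ε _), mul_comm (2 * M₀)]
      exact mul_le_mul_of_nonneg_left (hb _) (lamKTrunc_nonneg ε _)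

end Hypotheses

/-! ### The scalar first/second-difference bridge -/

/-- **First differences = second differences, scalar version**: for an even kernel `K` and `a : ℝ³ → ℝ`,
`∫ K(x−y)(a x − a y) dy = ½ ∫ K(z)(2 a x − a(x+z) − a(x−z)) dz` (under the two integrability hypotheses). -/
theorem firstDiff_eq_secondDiff_real {a K : EuclideanSpace ℝ (Fin 3) → ℝ} (hK : ∀ z, K (-z) = K z)
    (x : EuclideanSpace ℝ (Fin 3))
    (h1 : Integrable (fun z => K z * (a x - a (x + z))))
    (h2 : Integrable (fun z => K z * (a x - a (x - z)))) :
    ∫ y, K (x - y) * (a x - a y) = (1 / 2 : ℝ) * ∫ z, K z * (2 * a x - a (x + z) - a (x - z)) := by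
  have hA : ∫ y, K (x - y) * (a x - a y) = ∫ z, K z * (a x - a (x - z)) := by
    rw [← integral_sub_left_eq_self (μ := volume) (fun y => K (x - y) * (a x - a y)) x]
    refine integral_congr_ae (Eventually.of_forall fun z => ?_)
    simp only [sub_sub_cancel]
  have hB : ∫ z, K z * (a x - a (x - z)) = ∫ z, K z * (a x - a (x + z)) := by
    rw [← integral_neg_eq_self (μ := volume) (fun z => K z * (a x - a (x - z)))]
    refine integral_congr_ae (Eventually.of_forall fun z => ?_)
    simp only [hK, sub_neg_eq_add]
  have hsum : ∫ z, K z * (2 * a x - a (x + z) - a (x - z)) =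
      (∫ z, K z * (a x - a (x + z))) + ∫ z, K z * (a x - a (x - z)) := by
    rw [← integral_add h1 h2]
    refine integral_congr_ae (Eventually.of_forall fun z => ?_)
    ring
  rw [hA, hsum, ← hB]
  ring

/-! ### The truncated symmetrisation identity in second-difference form -/

/-- **The symmetrisation identity for the truncated kernel `K_ε`, everything discharged, both operators in
second-difference form**: for `ε > 0`, a bounded measurable integrable weight `a` and a bounded continuous field `f`,
`∫ a(x)⟪f x, ½∫K_ε(z)(2f x − f(x+z) − f(x−z))dz⟫dx = ¼∬(a x + a y)K_ε(x−y)‖f x − f y‖² + ½∫‖f x‖²(½∫K_ε(z)(2a x − a(x+z) − a(x−z))dz)dx`. -/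
theorem truncated_symmetrisation {a : EuclideanSpace ℝ (Fin 3) → ℝ}
    {f : EuclideanSpace ℝ (Fin 3) → EuclideanSpace ℝ (Fin 3)} {A₀ M₀ ε : ℝ}
    (ham : Measurable a) (hai : Integrable a) (ha0 : ∀ x, |a x| ≤ A₀)
    (hfc : Continuous f) (hf0 : ∀ x, ‖f x‖ ≤ M₀) (hε : 0 < ε) :
    ∫ x, a x * ⟪f x, (1 / 2 : ℝ) • ∫ z, lamKTrunc ε z • ((2 : ℝ) • f x - f (x + z) - f (x - z))⟫ =
      (1 / 4 : ℝ) * (∫ p : EuclideanSpace ℝ (Fin 3) × EuclideanSpace ℝ (Fin 3), symG a f (lamKTrunc ε) p) +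
        (1 / 2 : ℝ) * ∫ x, ‖f x‖ ^ 2 *
          ((1 / 2 : ℝ) * ∫ z, lamKTrunc ε z * (2 * a x - a (x + z) - a (x - z))) := by
  have hKev : ∀ z, lamKTrunc ε (-z) = lamKTrunc ε z := lamKTrunc_neg ε
  have hid := locHelicity_symmetrisation hKev (integrable_symF_trunc ham hai hfc hf0 hε)
    (integrable_symG_trunc ham hai hfc hf0 hε) (integrable_symS_trunc ham hai hfc hf0 hε)
    (integrable_firstDiff_trunc hfc hf0 hε)
  -- rewrite the two first-difference operators in second-difference form
  have hL : ∀ x, ∫ y, lamKTrunc ε (x - y) • (f x - f y) =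
      (1 / 2 : ℝ) • ∫ z, lamKTrunc ε z • ((2 : ℝ) • f x - f (x + z) - f (x - z)) := fun x =>
    firstDiff_eq_secondDiff hKev x (integrable_shiftDiff_trunc hfc hf0 hε x).1
      (integrable_shiftDiff_trunc hfc hf0 hε x).2
  have hA1 : ∀ w : EuclideanSpace ℝ (Fin 3), |a w| ≤ |A₀| := fun w => (ha0 w).trans (le_abs_self _)
  have hLa : ∀ x, ∫ y, lamKTrunc ε (x - y) * (a x - a y) =
      (1 / 2 : ℝ) * ∫ z, lamKTrunc ε z * (2 * a x - a (x + z) - a (x - z)) := by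
    intro x
    have hk : Integrable (lamKTrunc ε) := integrable_lamKTrunc hε
    have hb : ∀ w : EuclideanSpace ℝ (Fin 3), |a x - a w| ≤ 2 * |A₀| := fun w => by
      calc |a x - a w| ≤ |a x| + |a w| := abs_sub _ _
        _ ≤ |A₀| + |A₀| := add_le_add (hA1 _) (hA1 _)
        _ = 2 * |A₀| := by ring
    refine firstDiff_eq_secondDiff_real hKev x ?_ ?_
    · refine (hk.const_mul (2 * |A₀|)).mono' ?_ (Eventually.of_forall fun z => ?_)
      · exact ((measurable_lamKTrunc ε).mul
          ((ham.comp measurable_const).sub (ham.comp (measurable_const.add measurable_id)))).aestronglyMeasurable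
      · rw [Real.norm_eq_abs, abs_mul, abs_of_nonneg (lamKTrunc_nonneg ε _), mul_comm (2 * |A₀|)]
        exact mul_le_mul_of_nonneg_left (hb _) (lamKTrunc_nonneg ε _)
    · refine (hk.const_mul (2 * |A₀|)).mono' ?_ (Eventually.of_forall fun z => ?_)
      · exact ((measurable_lamKTrunc ε).mul
          ((ham.comp measurable_const).sub (ham.comp (measurable_const.sub measurable_id)))).aestronglyMeasurable
      · rw [Real.norm_eq_abs, abs_mul, abs_of_nonneg (lamKTrunc_nonneg ε _), mul_comm (2 * |A₀|)]
        exact mul_le_mul_of_nonneg_left (hb _) (lamKTrunc_nonneg ε _)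
  have e1 : (fun x => a x * ⟪f x, (1 / 2 : ℝ) • ∫ z, lamKTrunc ε z • ((2 : ℝ) • f x - f (x + z) - f (x - z))⟫) =
      fun x => a x * ⟪f x, ∫ y, lamKTrunc ε (x - y) • (f x - f y)⟫ := by
    funext x; rw [hL x]
  have e2 : (fun x => ‖f x‖ ^ 2 * ((1 / 2 : ℝ) * ∫ z, lamKTrunc ε z * (2 * a x - a (x + z) - a (x - z)))) =
      fun x => ‖f x‖ ^ 2 * ∫ y, lamKTrunc ε (x - y) * (a x - a y) := by
    funext x; rw [hLa x]
  rw [e1, e2]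
  exact hid

end Summit.NavierStokesRegularity.NavierStokesRegularity.Theorems.ChiralWindowDoorTruncatedSymmetrisation
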